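import Summits.BirchSwinnertonDyer.Rank1Residual.X11b.RegMultCertificateJoin
import Literature.Barriers.BirchSwinnertonDyer.PAdicHeightNondegeneracyProofs
import Literature.NumberTheory.EllipticCurves.MordellWeilTheoremProofs
import Summits.BirchSwinnertonDyer.BirchSwinnertonDyer.Theses.KolyvaginRoadThree
import HarnessLib

/-!
# Route `KolyvaginRoadThree`, crux `SchneiderTamAtThree` (item 19154): the registered skeleton is TIGHT —
# the deciding stub `stub_heightAnisotropicTamAtThree` is EQUIVALENT to the crux modulo the other stub
# `stub_rankOneTamAtThree` (= GZK on the Tamagawa cells of the class), by tree theorems only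
# (cell `bsd-stepL`, seat `bsd-stepL-reg3-eng` g7; `--supports stmt-BirchSwinnertonDyer-19154 --as helper`;
# KOLY twin of `ClassRecordThreeSchneiderAtThreeStubTight.lean`)

HONEST FRAMING: nothing here proves the crux, a stub, or BSD; 0 definitions, 0 named facts, 0 sorry. The crux
`SchneiderTamAtThree` (= `ClassRecordThree.SchneiderAtThree` restricted to `3 ∣ ∏ c_ℓ`; Schneider
non-degeneracy of THE canonical non-split-multiplicative `3`-adic height, OPEN class-wide — barrier
`Literature.Barriers.BirchSwinnertonDyer.PAdicHeightNondegeneracy`) has the registered BC3 skeleton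
(`Cruxes/SchneiderTamAtThree`, planner g24, sha fdde84d9…) with stubs

* `stub_rankOneTamAtThree : ∀ W, ClassX11b W 3 → 3 ∣ ∏ c_ℓ → rank_ℤ E(ℚ) = 1` (GZK on the cells; PUB by name —
  `rankOneTam_of_GZK` below), and
* `stub_heightAnisotropicTamAtThree` (ANISOTROPY of THE canonical datum on points of infinite order, on the cells).

Recorded here: GIVEN the rank-one stub, the crux IMPLIES the anisotropy stub (`anisotropyTam_of_schneiderTamAtThree`,
by `PAdicHeightData.not_schneiderConjecture_of_rank_one`), hence `schneiderTamAtThree_iff_anisotropyTam` — the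
deciding stub is NOT a strengthening of the crux; with GZK by name `schneiderTamAtThree_iff_anisotropyTam_of_GZK`.

References: [SteinWuthrich2013] §4.2 and Conj. 4.1; [Schneider1982PadicHeightI] §1; tree files
`Literature/Barriers/BirchSwinnertonDyer/PAdicHeightNondegeneracyProofs.lean`, `X11b/RegMultCertificateJoin.lean`.
-/

open scoped Classical

open WeierstrassCurve Literature.NumberTheory.EllipticCurves
  Literature.NumberTheory.EllipticCurves.Rank1Residual
  Literature.NumberTheory.EllipticCurves.SteinWuthrich2013
  Summit.BirchSwinnertonDyer.Rank1Residual
  Summit.BirchSwinnertonDyer.Rank1Residual.X11b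

namespace Summit.BirchSwinnertonDyer.Rank1Residual.X11b.RegMult.SchneiderTamAtThreeStub

/-- **Crux ⟹ deciding stub, given rank one on the cells** (both stub texts verbatim): an isotropic non-torsion
`P` would give `Reg₃(E, Dh) = 0` in rank one (`PAdicHeightData.not_schneiderConjecture_of_rank_one`),
contradicting the non-split half of `ClassClosure.RegulatorNonvanishingAt W 3`. [folklore] -/
theorem anisotropyTam_of_schneiderTamAtThree
    (hr : ∀ (W : WeierstrassCurve ℚ) [W.IsElliptic] [W.IsGloballyMinimal],
      Summit.BirchSwinnertonDyer.Rank1Residual.ClassX11b W 3 → 3 ∣ W.tamagawaProduct → W.mordellWeilRank = 1)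
    (h : Summit.BirchSwinnertonDyer.BirchSwinnertonDyer.Theses.KolyvaginRoadThree.SchneiderTamAtThree) :
    ∀ (W : WeierstrassCurve ℚ) [W.IsElliptic] [W.IsGloballyMinimal],
      Summit.BirchSwinnertonDyer.Rank1Residual.ClassX11b W 3 →
      Literature.NumberTheory.EllipticCurves.Rank1Residual.Ram W 3 →
      ¬ W.HasSplitMultiplicativeReductionAtPrime 3 → 3 ∣ W.tamagawaProduct →
      ∀ (q : ℚ_[3]) (Dh : WeierstrassCurve.PAdicHeightData W 3), q ≠ 0 → ‖q‖ < 1 →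
        Literature.NumberTheory.EllipticCurves.tateJ q = (W.j : ℚ_[3]) →
        Literature.NumberTheory.EllipticCurves.SteinWuthrich2013.IsMultCanonical Dh q →
        ∀ (P : W.toAffine.Point), ¬ IsOfFinAddOrder P → Dh.pairing P P ≠ 0 := by
  intro W _ _ hX hram hns htam q Dh hq0 hq1 hj hcan P hP hPP
  exact Dh.not_schneiderConjecture_of_rank_one (hr W hX htam) hP hPP
    ((h W hX hram hns htam).1 q Dh hq0 hq1 hj hcan)

/-- **Deciding stub ⟹ crux, given rank one on the cells** (the skeleton's composition `SchneiderTamAtThree_of`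
with both stubs as hypotheses): `PAdicHeightData.not_schneiderConjecture_iff_of_rank_one` with the Mordell–Weil
THEOREM `exists_isMordellWeilBasis_holds`; split clause vacuous (`TateParameterData.split`). [folklore] -/
theorem schneiderTamAtThree_of_anisotropyTam
    (hr : ∀ (W : WeierstrassCurve ℚ) [W.IsElliptic] [W.IsGloballyMinimal],
      Summit.BirchSwinnertonDyer.Rank1Residual.ClassX11b W 3 → 3 ∣ W.tamagawaProduct → W.mordellWeilRank = 1)
    (ha : ∀ (W : WeierstrassCurve ℚ) [W.IsElliptic] [W.IsGloballyMinimal],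
      Summit.BirchSwinnertonDyer.Rank1Residual.ClassX11b W 3 →
      Literature.NumberTheory.EllipticCurves.Rank1Residual.Ram W 3 →
      ¬ W.HasSplitMultiplicativeReductionAtPrime 3 → 3 ∣ W.tamagawaProduct →
      ∀ (q : ℚ_[3]) (Dh : WeierstrassCurve.PAdicHeightData W 3), q ≠ 0 → ‖q‖ < 1 →
        Literature.NumberTheory.EllipticCurves.tateJ q = (W.j : ℚ_[3]) →
        Literature.NumberTheory.EllipticCurves.SteinWuthrich2013.IsMultCanonical Dh q →
        ∀ (P : W.toAffine.Point), ¬ IsOfFinAddOrder P → Dh.pairing P P ≠ 0) :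
    Summit.BirchSwinnertonDyer.BirchSwinnertonDyer.Theses.KolyvaginRoadThree.SchneiderTamAtThree := by
  intro W _ _ hX hram hns htam
  refine ⟨fun q Dh hq0 hq1 hj hcan ↦ ?_, fun Dq Dh _ ↦ absurd Dq.split hns⟩
  by_contra hS
  obtain ⟨P, hP, hPP⟩ :=
    (Dh.not_schneiderConjecture_iff_of_rank_one (hr W hX htam) W.exists_isMordellWeilBasis_holds).mp hS
  exact ha W hX hram hns htam q Dh hq0 hq1 hj hcan P hP hPP

/-- **TIGHTNESS of the registered skeleton of crux 19154**: modulo its first stub, the crux `SchneiderTamAtThree`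
is EQUIVALENT to its deciding stub `stub_heightAnisotropicTamAtThree` (texts verbatim). [folklore] -/
theorem schneiderTamAtThree_iff_anisotropyTam
    (hr : ∀ (W : WeierstrassCurve ℚ) [W.IsElliptic] [W.IsGloballyMinimal],
      Summit.BirchSwinnertonDyer.Rank1Residual.ClassX11b W 3 → 3 ∣ W.tamagawaProduct → W.mordellWeilRank = 1) :
    Summit.BirchSwinnertonDyer.BirchSwinnertonDyer.Theses.KolyvaginRoadThree.SchneiderTamAtThree ↔
    ∀ (W : WeierstrassCurve ℚ) [W.IsElliptic] [W.IsGloballyMinimal],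
      Summit.BirchSwinnertonDyer.Rank1Residual.ClassX11b W 3 →
      Literature.NumberTheory.EllipticCurves.Rank1Residual.Ram W 3 →
      ¬ W.HasSplitMultiplicativeReductionAtPrime 3 → 3 ∣ W.tamagawaProduct →
      ∀ (q : ℚ_[3]) (Dh : WeierstrassCurve.PAdicHeightData W 3), q ≠ 0 → ‖q‖ < 1 →
        Literature.NumberTheory.EllipticCurves.tateJ q = (W.j : ℚ_[3]) →
        Literature.NumberTheory.EllipticCurves.SteinWuthrich2013.IsMultCanonical Dh q →
        ∀ (P : W.toAffine.Point), ¬ IsOfFinAddOrder P → Dh.pairing P P ≠ 0 :=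
  ⟨fun h W _ _ ↦ anisotropyTam_of_schneiderTamAtThree hr h W,
    fun ha ↦ schneiderTamAtThree_of_anisotropyTam hr (fun W _ _ ↦ ha W)⟩

/-- **The first stub from GZK by name** (`stub_rankOneTamAtThree`, text verbatim; the Tamagawa binder is not
used). [cite: KolyvaginEulerSystems1990, Thm. A] -/
theorem rankOneTam_of_GZK (hGZK : rank_eq_analyticRank_of_analyticRank_le_one) :
    ∀ (W : WeierstrassCurve ℚ) [W.IsElliptic] [W.IsGloballyMinimal],
      Summit.BirchSwinnertonDyer.Rank1Residual.ClassX11b W 3 → 3 ∣ W.tamagawaProduct → W.mordellWeilRank = 1 :=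
  fun _ _ _ hX _ ↦ mordellWeilRank_eq_one_of_analyticRank hGZK hX.1

/-- **TIGHTNESS modulo GZK**: `SchneiderTamAtThree ↔ stub_heightAnisotropicTamAtThree` given the named fact
`rank_eq_analyticRank_of_analyticRank_le_one`. [cite: KolyvaginEulerSystems1990, Thm. A]
[cite: SteinWuthrich2013, §4.2 and Conj. 4.1] -/
theorem schneiderTamAtThree_iff_anisotropyTam_of_GZK (hGZK : rank_eq_analyticRank_of_analyticRank_le_one) :
    Summit.BirchSwinnertonDyer.BirchSwinnertonDyer.Theses.KolyvaginRoadThree.SchneiderTamAtThree ↔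
    ∀ (W : WeierstrassCurve ℚ) [W.IsElliptic] [W.IsGloballyMinimal],
      Summit.BirchSwinnertonDyer.Rank1Residual.ClassX11b W 3 →
      Literature.NumberTheory.EllipticCurves.Rank1Residual.Ram W 3 →
      ¬ W.HasSplitMultiplicativeReductionAtPrime 3 → 3 ∣ W.tamagawaProduct →
      ∀ (q : ℚ_[3]) (Dh : WeierstrassCurve.PAdicHeightData W 3), q ≠ 0 → ‖q‖ < 1 →
        Literature.NumberTheory.EllipticCurves.tateJ q = (W.j : ℚ_[3]) →
        Literature.NumberTheory.EllipticCurves.SteinWuthrich2013.IsMultCanonical Dh q →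
        ∀ (P : W.toAffine.Point), ¬ IsOfFinAddOrder P → Dh.pairing P P ≠ 0 :=
  schneiderTamAtThree_iff_anisotropyTam (rankOneTam_of_GZK hGZK)

end Summit.BirchSwinnertonDyer.Rank1Residual.X11b.RegMult.SchneiderTamAtThreeStub
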